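import Summits.QuantumAdvantage.QuantumAdvantage.Theorems.NearExactIsExact.Negative.SkewProductCore

/-!
# `NearExactIsExact` (stmt-QuantumAdvantage-14043) — negative lemma: the REFLECTED PAIR with one
  quadratic coordinate (gen 42 disprover; the γ-frames of the `naff = 5` stratum of BQ-11)

Companion of `Negative/ReflectedFlatPair.lean` (THEOREM CENSUS-K census-free: every K-frame, `E = 0`, dies
by the reflected FLAT pair).  For the remaining two-sided `naff = 5` frames — the γ-frames `E ≠ 0, A ≠ 0`
of DISPROOF.md §47.27/47.33 (THEOREM GAMMA-CENSUS-19, computational: 19 091 classes, 49 core-hours) — the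
reflection `S₁ = π⁻¹(π(S₀) ⊕ e_{x₅})` of the zero section `S₀` is NO LONGER a flat: the `E`-term
`z₅ ⊕= s₀s₁` of the normal position makes exactly one coordinate of the reflected section quadratic.
Exact numerics (folder `kcert/gcert_probe.py`, `gcert_coords.py`; two-sided γ-members generated and
oracle-verified with disprove-g41's gsweep chain, `deg π = deg π⁻¹ = 2` re-checked from the tables): in
16/16 members the reflected section `t` has all coordinates affine except at most ONE of degree `2`
(12× one, 4× none), and the two-section certificate {zero section, reflected section} with constant
weights is valid 16/16.  The reason is the lemma below: if `σ₁` is affine in all coordinates but one of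
degree `≤ 2`, then `c₁∘σ₁` still has degree `≤ 3 + 1 = 4 < 5` for cubic `c₁` (Shannon expansion in that
coordinate: `c₁(x) = c₁(x⁻) ⊕ x_{j₀}·(Δ_{j₀}c₁)(x⁻)`, degrees `3` and `2 + 2`), so the parity argument of the
reflected flat pair goes through unchanged.

* `comp_deg_affine_but_one` — cubic ∘ (affine but one quadratic coordinate) has degree `≤ 4`;
* `reflected_pair_graph` — `c₁ ⊕ c₂∘π = U`, `σ₀` affine with `π∘σ₀` quadratic, `σ₁` affine but one
  quadratic coordinate, `π∘σ₁ = π∘σ₀ ⊕ e` ⇒ `U` has even mass on `σ₀, σ₁` (any `n`, any `π`);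
* `gframe_empty` — the K/γ-model corollary: zero section with quadratic image + ONE reflected section
  `t` (affine but one quadratic coordinate, `t(0)₀ = 1`) ⇒ no cubic pair with residual `[ū = 0][s₀ = 0]`.

With the (paper, numerically verified) normal-form fact that every two-sided `naff = 5` frame has such a
reflected section, the WHOLE two-sided `naff = 5` stratum of BQ-11 is empty by one parity argument.
HONEST FRAMING: a kernel-checked negative lemma plus exact finite checks; NOT summit progress — the
normal-form fact for γ-frames is not formalised here, and `naff ≤ 4`, `naff = 0`, the crux and the summit
are untouched.
-/

set_option linter.dupNamespace false -- D-0017: single-problem summit ⇒ `QuantumAdvantage.QuantumAdvantage` by design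

namespace Summit.QuantumAdvantage.QuantumAdvantage.Theorems.NearExactIsExact.Negative.ReflectedPairGraph

open Finset
open Literature.Computability.QuantumComplexity
open Literature.Computability.QuantumComplexity.BuzetChailloux (bxor)
open Summit.QuantumAdvantage.QuantumAdvantage.Theorems.CubicForrelation.NearExactIsExact
  (fc_isDegLeFun_comp fc_deg_bxor fc_sum_signOf_eq_card stub_axParity stub_derivDegree te_isDegLeFun_band)
open Summit.QuantumAdvantage.QuantumAdvantage.Theorems.NearExactIsExact.Negative.BqqSeven
  (natCast_eq_zero_of_even)
open Summit.QuantumAdvantage.QuantumAdvantage.Theorems.NearExactIsExact.Negative.SkewProductCore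

/-- Ax / McEliece on `5` bits: a Boolean function of degree `d ≤ 4` has `Σ_x ind (F x) = 0`. [folklore] -/
theorem sum_ind_eq_zero_of_deg_le_four {F : (Fin 5 → Bool) → Bool} {d : ℕ} (hd : d ≤ 4)
    (hF : IsDegLeFun d F) : ∑ x, ind (F x) = 0 := by
  obtain ⟨z, hz⟩ := stub_axParity 5 4 F univ (by norm_num) (hF.mono hd)
  rw [filter_true_of_mem (fun u _ i _ => mem_univ i), card_fin, fc_sum_signOf_eq_card] at hz
  have h4 : (2 : ℝ) ^ ((5 + 4 - 1) / 4) = 4 := by norm_num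
  rw [h4] at hz
  have hc : (((univ.filter fun x : Fin 5 → Bool => F x = true).card : ℤ) : ℝ) =
      ((2 * (8 - z) : ℤ) : ℝ) := by
    push_cast
    linear_combination (-(1 : ℝ) / 2) * hz
  have he : Even (((univ.filter fun x : Fin 5 → Bool => F x = true).card : ℤ)) :=
    ⟨8 - z, by rw [Int.cast_injective hc]; ring⟩
  rw [sum_ind]
  exact natCast_eq_zero_of_even ((Int.even_coe_nat _).mp he)

/-- `x⁻ ⊕ e_{j₀} = x⁺`. [folklore] -/
theorem bxor_update_false_single {n : ℕ} (x : Fin n → Bool) (j₀ : Fin n) :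
    bxor (Function.update x j₀ false) (fun i => decide (i = j₀)) = Function.update x j₀ true := by
  funext i
  by_cases hi : i = j₀
  · subst hi; simp [bxor]
  · simp [bxor, hi]

/-- Shannon expansion in one coordinate, Boolean form:
`c x = c x⁻ ⊕ x_{j₀}·(c x⁻ ⊕ c (x⁻ ⊕ e_{j₀}))`. [folklore] -/
theorem shannon_bool {n : ℕ} (c : (Fin n → Bool) → Bool) (j₀ : Fin n) (x : Fin n → Bool) :
    c x = (c (Function.update x j₀ false) ^^ (x j₀ &&
      (c (Function.update x j₀ false) ^^
        c (bxor (Function.update x j₀ false) (fun i => decide (i = j₀)))))) := by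
  rw [bxor_update_false_single]
  cases hx : x j₀
  · have e : Function.update x j₀ false = x := by rw [← hx, Function.update_eq_self]
    rw [e]; simp
  · have e : Function.update x j₀ true = x := by rw [← hx, Function.update_eq_self]
    rw [e]
    cases c (Function.update x j₀ false) <;> cases c x <;> rfl

/-- Zeroing the special coordinate of a map that is affine elsewhere gives an affine map. [folklore] -/
theorem update_false_coord_deg {n : ℕ} (σ : (Fin 5 → Bool) → (Fin n → Bool)) (j₀ : Fin n)
    (hσ : ∀ j, j ≠ j₀ → IsDegLeFun 1 (fun v => σ v j)) :
    ∀ j, IsDegLeFun 1 (fun v => Function.update (σ v) j₀ false j) := by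
  intro j
  by_cases hj : j = j₀
  · subst hj
    have e : (fun v => Function.update (σ v) j false j) = fun _ => false :=
      funext fun v => Function.update_self j false (σ v)
    rw [e]; exact isDegLeFun_const 1 false
  · have e : (fun v => Function.update (σ v) j₀ false j) = fun v => σ v j :=
      funext fun v => Function.update_of_ne hj false (σ v)
    rw [e]; exact hσ j hj

/-- **Cubic ∘ (affine but one quadratic coordinate) has degree `≤ 4`.** [folklore] -/
theorem comp_deg_affine_but_one {n : ℕ} (c : (Fin n → Bool) → Bool) (hc : IsDegLeFun 3 c)
    (σ : (Fin 5 → Bool) → (Fin n → Bool)) (j₀ : Fin n)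
    (hσ : ∀ j, j ≠ j₀ → IsDegLeFun 1 (fun v => σ v j)) (hq : IsDegLeFun 2 (fun v => σ v j₀)) :
    IsDegLeFun 4 (fun v => c (σ v)) := by
  have hτ := update_false_coord_deg σ j₀ hσ
  have hA : IsDegLeFun 3 (fun v : Fin 5 → Bool => c (Function.update (σ v) j₀ false)) :=
    fc_isDegLeFun_comp hc (fun v => Function.update (σ v) j₀ false) hτ (by norm_num)
  have hD : IsDegLeFun 2 (fun v : Fin 5 → Bool => c (Function.update (σ v) j₀ false) ^^
      c (bxor (Function.update (σ v) j₀ false) (fun i => decide (i = j₀)))) :=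
    fc_isDegLeFun_comp (stub_derivDegree n 2 c (fun i => decide (i = j₀)) hc)
      (fun v => Function.update (σ v) j₀ false) hτ (by norm_num)
  have e : (fun v => c (σ v)) = fun v => (c (Function.update (σ v) j₀ false) ^^ (σ v j₀ &&
      (c (Function.update (σ v) j₀ false) ^^
        c (bxor (Function.update (σ v) j₀ false) (fun i => decide (i = j₀)))))) :=
    funext fun v => shannon_bool c j₀ (σ v)
  rw [e]
  exact fc_deg_bxor (hA.mono (by norm_num)) (te_isDegLeFun_band hq hD)

/-- **REFLECTED PAIR, graph version.** If `c₁ ⊕ c₂∘π = U` with `c₁, c₂` cubic, `σ₀ : 𝔽₂⁵ → 𝔽₂^n` affine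
with `π∘σ₀` quadratic, `σ₁` affine in every coordinate but `j₀` (of degree `≤ 2`), and
`π∘σ₁ = π∘σ₀ ⊕ e`, then `U` has even total mass on `σ₀, σ₁`. [folklore] -/
theorem reflected_pair_graph {n : ℕ} (π : (Fin n → Bool) → (Fin n → Bool))
    (c₁ c₂ : (Fin n → Bool) → Bool) (h₁ : IsDegLeFun 3 c₁) (h₂ : IsDegLeFun 3 c₂)
    (U : (Fin n → Bool) → Bool) (hres : ∀ z, (c₁ z ^^ c₂ (π z)) = U z)
    (σ₀ σ₁ : (Fin 5 → Bool) → (Fin n → Bool)) (hσ₀ : ∀ j, IsDegLeFun 1 (fun v => σ₀ v j))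
    (j₀ : Fin n) (hσ₁ : ∀ j, j ≠ j₀ → IsDegLeFun 1 (fun v => σ₁ v j))
    (hq : IsDegLeFun 2 (fun v => σ₁ v j₀))
    (hπ : ∀ j, IsDegLeFun 2 (fun v => π (σ₀ v) j)) (e : Fin n → Bool)
    (hrefl : ∀ v, π (σ₁ v) = bxor (π (σ₀ v)) e) :
    ∑ v, ind (U (σ₀ v)) + ∑ v, ind (U (σ₁ v)) = 0 := by
  have hc0 : IsDegLeFun 3 (fun v : Fin 5 → Bool => c₁ (σ₀ v)) :=
    fc_isDegLeFun_comp h₁ σ₀ hσ₀ (by norm_num)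
  have hc1 : IsDegLeFun 4 (fun v : Fin 5 → Bool => c₁ (σ₁ v)) :=
    comp_deg_affine_but_one c₁ h₁ σ₁ j₀ hσ₁ hq
  have hD : IsDegLeFun 4 (fun v : Fin 5 → Bool => c₂ (π (σ₀ v)) ^^ c₂ (bxor (π (σ₀ v)) e)) :=
    fc_isDegLeFun_comp (stub_derivDegree n 2 c₂ e h₂) (fun v => π (σ₀ v)) hπ (by norm_num)
  have hpt : ∀ v : Fin 5 → Bool, ind (U (σ₀ v)) + ind (U (σ₁ v)) =
      ind (c₁ (σ₀ v)) + ind (c₁ (σ₁ v)) + ind (c₂ (π (σ₀ v)) ^^ c₂ (bxor (π (σ₀ v)) e)) := by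
    intro v
    rw [← hres (σ₀ v), ← hres (σ₁ v), hrefl v, ind_xor, ind_xor, ind_xor]
    ring
  rw [← sum_add_distrib, sum_congr rfl (fun v _ => hpt v), sum_add_distrib, sum_add_distrib,
    sum_ind_eq_zero_of_deg_le_four (by norm_num) hc0, sum_ind_eq_zero_of_deg_le_four le_rfl hc1,
    sum_ind_eq_zero_of_deg_le_four le_rfl hD, add_zero, add_zero]

/-- Coordinates of the graph `v ↦ (v, t v)` off the special fibre coordinate `k₀` are affine when `t` is
affine off `k₀`. [folklore] -/
theorem graph_coord_deg_but_one {r : ℕ} (t : (Fin 5 → Bool) → Fin r → Bool) (k₀ : Fin r)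
    (ht : ∀ k, k ≠ k₀ → IsDegLeFun 1 (fun v => t v k)) :
    ∀ j : Fin (5 + r), j ≠ Fin.natAdd 5 k₀ →
      IsDegLeFun 1 (fun v : Fin 5 → Bool => Fin.append v (t v) j) := by
  intro j hj
  induction j using Fin.addCases with
  | left i =>
    have e : (fun v : Fin 5 → Bool => Fin.append v (t v) (Fin.castAdd r i)) = fun v => v i :=
      funext fun v => Fin.append_left v _ i
    rw [e]; exact isDegLeFun_apply i le_rfl
  | right k =>
    have hk : k ≠ k₀ := fun h => hj (by rw [h])
    have e : (fun v : Fin 5 → Bool => Fin.append v (t v) (Fin.natAdd 5 k)) = fun v => t v k :=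
      funext fun v => Fin.append_right v _ k
    rw [e]; exact ht k hk

/-- **Every K/γ-frame with an (affine but one quadratic coordinate) reflected section is empty.**
K/γ-model: source `(ū, s) ∈ 𝔽₂^{5+6}`, residual `[ū = 0][s₀ = 0]`; the zero section has a quadratic
image, and ONE section `t` — affine in every fibre coordinate but `k₀`, where it has degree `≤ 2`, with
`t(0)₀ = 1` — is the reflection of the zero section through a constant target vector.  Then no cubic pair
has that residual.  (`E = 0`: `t = K⁻¹e_{s₀}` affine — `Negative/ReflectedFlatPair.kframe_empty`; `E ≠ 0`
γ-frames: `t₄` quadratic, 16/16 numerically.) [folklore] -/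
theorem gframe_empty (π : (Fin (5 + 6) → Bool) → (Fin (5 + 6) → Bool))
    (c₁ c₂ : (Fin (5 + 6) → Bool) → Bool) (h₁ : IsDegLeFun 3 c₁) (h₂ : IsDegLeFun 3 c₂)
    (hres : ∀ z, (c₁ z ^^ c₂ (π z)) =
      (decide (∀ i : Fin 5, z (Fin.castAdd 6 i) = false) && !z (Fin.natAdd 5 0)))
    (hπ : ∀ j, IsDegLeFun 2 (fun v : Fin 5 → Bool => π (Fin.append v (fun _ => false)) j))
    (t : (Fin 5 → Bool) → Fin 6 → Bool) (k₀ : Fin 6)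
    (ht : ∀ k, k ≠ k₀ → IsDegLeFun 1 (fun v => t v k)) (htq : IsDegLeFun 2 (fun v => t v k₀))
    (ht0 : t (fun _ => false) 0 = true) (e : Fin (5 + 6) → Bool)
    (hrefl : ∀ v, π (Fin.append v (t v)) = bxor (π (Fin.append v (fun _ => false))) e) :
    False := by
  have hq : IsDegLeFun 2 (fun v : Fin 5 → Bool => Fin.append v (t v) (Fin.natAdd 5 k₀)) := by
    have e' : (fun v : Fin 5 → Bool => Fin.append v (t v) (Fin.natAdd 5 k₀)) = fun v => t v k₀ :=
      funext fun v => Fin.append_right v _ k₀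
    rw [e']; exact htq
  have hz : ∀ j, IsDegLeFun 1 (fun v : Fin 5 → Bool => Fin.append v (fun _ : Fin 6 => false) j) := by
    intro j
    induction j using Fin.addCases with
    | left i =>
      have e' : (fun v : Fin 5 → Bool => Fin.append v (fun _ : Fin 6 => false) (Fin.castAdd 6 i)) =
          fun v => v i := funext fun v => Fin.append_left v _ i
      rw [e']; exact isDegLeFun_apply i le_rfl
    | right k =>
      have e' : (fun v : Fin 5 → Bool => Fin.append v (fun _ : Fin 6 => false) (Fin.natAdd 5 k)) =
          fun _ => false := funext fun v => Fin.append_right v _ k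
      rw [e']; exact isDegLeFun_const 1 false
  have h := reflected_pair_graph π c₁ c₂ h₁ h₂ _ hres (fun v => Fin.append v (fun _ => false))
    (fun v => Fin.append v (t v)) hz (Fin.natAdd 5 k₀) (graph_coord_deg_but_one t k₀ ht) hq hπ e hrefl
  have h0 : ∑ v : Fin 5 → Bool, ind (decide (∀ i : Fin 5,
      Fin.append v (fun _ : Fin 6 => false) (Fin.castAdd 6 i) = false) &&
        !Fin.append v (fun _ : Fin 6 => false) (Fin.natAdd 5 0)) = 1 := by
    simp only [Fin.append_left, Fin.append_right, Bool.not_false, Bool.and_true]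
    rw [Finset.sum_eq_single (fun _ => false)]
    · simp
    · intro u _ hu
      have hu' : ¬ ∀ i, u i = false := fun h' => hu (funext h')
      simp [hu']
    · intro h'
      exact absurd (mem_univ _) h'
  have h1 : ∑ v : Fin 5 → Bool, ind (decide (∀ i : Fin 5,
      Fin.append v (t v) (Fin.castAdd 6 i) = false) && !Fin.append v (t v) (Fin.natAdd 5 0)) = 0 := by
    refine sum_eq_zero fun v _ => ?_
    simp only [Fin.append_left, Fin.append_right]
    by_cases hv : ∀ i, v i = false
    · have ev : v = fun _ => false := funext hv
      subst ev
      rw [ht0]; simp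
    · simp [hv]
  rw [h0, h1, add_zero] at h
  exact one_ne_zero h

end Summit.QuantumAdvantage.QuantumAdvantage.Theorems.NearExactIsExact.Negative.ReflectedPairGraph
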